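import Literature.MathematicalPhysics.StatisticalMechanics.BarlowStacking
import Literature.MathematicalPhysics.StatisticalMechanics.HcpHomogeneous
import Summits.AtomisticToContinuum.Crystallization.Theorems.OneCentreSteepnessLadderZeroDensityOfDefectsBookkeeping

/-!
# Route `OneCentreSteepnessLadder`, item `DominationEnergyLimit`: the energy per particle of HCP

Helper file for item stmt-AtomisticToContinuum-12887 (`DominationEnergyLimit`).  For the relaxed
hexagonal close packing `hcpPeriodicConfiguration a h` (`a, h ≠ 0`; two-point motif, lattice
`ℤu + ℤv + ℤ(2h e₃)`) and ANY pair potential `V` with `V 0 = 0`: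

`e(hcp a h) = ½ ∑'_{p ∈ hcpStacking a h} V ‖p‖`  (`energyPerParticle_hcp_eq_half_tsum`)

— both motif sites see the same multiset of distances (HCP is vertex-transitive:
`hcpPeriodicConfiguration_homogeneous` gives a linear isometry `B` with `q ∈ hcp ↔ x + B q ∈ hcp`),
and the root term `V ‖0‖ = V 0 = 0` may be added harmlessly.  For the normalised Mie potential
`V_q = miePotential q` (`q ≠ 0`), `V_q(r) = −(1/(2q))·φ_q(r)` with `φ_q(r) = 2r⁻ᵠ − r⁻²ᵠ`
(`OneCentreSteepnessLadderZeroDensity.miePotential_eq_neg_mul_phi` of the sibling item), so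

`e(hcp a h) = −Φ_hcp(a,h)/(4q)`,  `Φ_hcp(a,h) = ∑'_{p ∈ hcpStacking a h} φ_q ‖p‖`
(`energyPerParticle_hcp_miePotential`), the one-centre value of the route's domination template.
No summability is needed (the identities hold for the `tsum` junk value too).  All `[folklore]`.
-/

noncomputable section

namespace Summit.AtomisticToContinuum.Crystallization.Theorems.DominationEnergyLimit

open Literature.MathematicalPhysics.StatisticalMechanics
open Summit.AtomisticToContinuum.Crystallization.Theorems.OneCentreSteepnessLadderZeroDensity
  (miePotential_zero miePotential_eq_neg_mul_phi)
open scoped BigOperators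

/-- Dropping a vanishing root term: if `F 0 = 0` then the sum of `F` over the non-zero points of a
set `S ⊂ ℝ³` equals the sum over all of `S`. [folklore] -/
theorem tsum_ne_zero_eq_tsum {S : Set (EuclideanSpace ℝ (Fin 3))} (F : EuclideanSpace ℝ (Fin 3) → ℝ)
    (hF : F 0 = 0) :
    ∑' p : {p : EuclideanSpace ℝ (Fin 3) // p ∈ S ∧ p ≠ 0}, F p.1 = ∑' p : S, F p.1 := by
  have h1 : ∑' p : {p : S // (p : EuclideanSpace ℝ (Fin 3)) ≠ 0}, F p.1.1 = ∑' p : S, F p.1 := by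
    refine tsum_subtype_eq_of_support_subset (f := fun p : S => F p.1)
      (s := {p : S | (p : EuclideanSpace ℝ (Fin 3)) ≠ 0}) ?_
    intro p hp
    simp only [Function.mem_support] at hp
    intro h0
    apply hp
    simp [h0, hF]
  rw [← h1]
  set e := Equiv.subtypeSubtypeEquivSubtypeInter (fun p : EuclideanSpace ℝ (Fin 3) => p ∈ S)
    (fun p : EuclideanSpace ℝ (Fin 3) => p ≠ 0) with he
  calc ∑' p : {p : EuclideanSpace ℝ (Fin 3) // p ∈ S ∧ p ≠ 0}, F p.1
      = ∑' b : {p : S // (p : EuclideanSpace ℝ (Fin 3)) ≠ 0}, F (e b).1 :=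
        (Equiv.tsum_eq e (fun p : {p : EuclideanSpace ℝ (Fin 3) // p ∈ S ∧ p ≠ 0} => F p.1)).symm
    _ = ∑' b : {p : S // (p : EuclideanSpace ℝ (Fin 3)) ≠ 0}, F b.1.1 := tsum_congr fun b => by simp [he]

/-- **One site of a vertex-transitive configuration**: if `x ∈ S` and a linear isometry `B`
satisfies `q ∈ S ↔ x + B q ∈ S`, then `∑'_{y ∈ S, y ≠ x} V(|x − y|) = ∑'_{q ∈ S, q ≠ 0} V ‖q‖`.
[folklore] -/
theorem tsum_site_eq_of_homogeneous {S : Set (EuclideanSpace ℝ (Fin 3))} (V : ℝ → ℝ)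
    {x : EuclideanSpace ℝ (Fin 3)} (B : EuclideanSpace ℝ (Fin 3) ≃ₗᵢ[ℝ] EuclideanSpace ℝ (Fin 3))
    (hB : ∀ q, q ∈ S ↔ x + B q ∈ S) :
    ∑' y : {y : EuclideanSpace ℝ (Fin 3) // y ∈ S ∧ y ≠ x}, V (dist x y.1) =
      ∑' q : {q : EuclideanSpace ℝ (Fin 3) // q ∈ S ∧ q ≠ 0}, V ‖q.1‖ := by
  -- the bijection `q ↦ x + B q`
  let e : {q : EuclideanSpace ℝ (Fin 3) // q ∈ S ∧ q ≠ 0} ≃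
      {y : EuclideanSpace ℝ (Fin 3) // y ∈ S ∧ y ≠ x} :=
    { toFun := fun q => ⟨x + B q.1, (hB q.1).1 q.2.1, fun h => q.2.2 (by
        have : B q.1 = 0 := by
          have h' : x + B q.1 = x + 0 := by rw [add_zero]; exact h
          exact add_left_cancel h'
        exact (LinearIsometryEquiv.map_eq_zero_iff B).1 this)⟩
      invFun := fun y => ⟨B.symm (y.1 - x), by
        constructor
        · rw [hB, LinearIsometryEquiv.apply_symm_apply, add_sub_cancel]
          exact y.2.1
        · intro h
          have : y.1 - x = 0 := by
            have := congrArg B h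
            rwa [LinearIsometryEquiv.apply_symm_apply, LinearIsometryEquiv.map_zero] at this
          exact y.2.2 (sub_eq_zero.1 this)⟩
      left_inv := fun q => Subtype.ext (by simp)
      right_inv := fun y => Subtype.ext (by simp) }
  rw [← Equiv.tsum_eq e]
  refine tsum_congr fun q => ?_
  show V (dist x (x + B q.1)) = V ‖q.1‖
  rw [dist_self_add_right, LinearIsometryEquiv.norm_map]

/-- **`e(hcp a h) = ½ ∑'_{p ∈ hcpStacking a h} V ‖p‖`** for every pair potential with `V 0 = 0`
and all `a, h ≠ 0`: each of the two motif sites has site sum `∑'_{q ∈ hcp, q ≠ 0} V ‖q‖` (HCP is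
homogeneous under linear isometries fixing the stacking up to the base point), and the root term
vanishes. [folklore] -/
theorem energyPerParticle_hcp_eq_half_tsum {a h : ℝ} (ha : a ≠ 0) (hh : h ≠ 0) (V : ℝ → ℝ)
    (hV : V 0 = 0) :
    (hcpPeriodicConfiguration ha hh).energyPerParticle V =
      (1 / 2) * ∑' p : ↥(hcpStacking a h), V ‖(p : EuclideanSpace ℝ (Fin 3))‖ := by
  set P := hcpPeriodicConfiguration ha hh with hP
  have hpts : P.points = hcpStacking a h := hcpPeriodicConfiguration_points ha hh
  set T : ℝ := ∑' p : ↥(hcpStacking a h), V ‖(p : EuclideanSpace ℝ (Fin 3))‖ with hT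
  have hsite : ∀ x ∈ P.motif,
      ∑' y : {y : EuclideanSpace ℝ (Fin 3) // y ∈ P.points ∧ y ≠ x}, V (dist x y.1) = T := by
    intro x hx
    obtain ⟨B, hB⟩ := hcpPeriodicConfiguration_homogeneous a h ha hh (P.mem_points_of_mem_motif hx)
    rw [tsum_site_eq_of_homogeneous V B hB, tsum_ne_zero_eq_tsum (fun p => V ‖p‖) (by simpa using hV),
      tsum_congr_set_coe (fun p : EuclideanSpace ℝ (Fin 3) => V ‖p‖) hpts]
  have hF : (0 : ℝ) < P.motif.card := by exact_mod_cast P.motif_nonempty.card_pos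
  unfold PeriodicConfiguration.energyPerParticle
  rw [Finset.sum_congr rfl hsite, Finset.sum_const, nsmul_eq_mul]
  field_simp

/-- **The energy per particle of relaxed HCP for the Mie `(2q,q)` potential**:
`e(hcp a h) = −Φ_hcp(a,h)/(4q)` with `Φ_hcp(a,h) = ∑'_{p ∈ hcpStacking a h} (2‖p‖⁻ᵠ − ‖p‖⁻²ᵠ)` the
hcp site value of the one-centre domination template (`a, h ≠ 0`, `q ≠ 0`). [folklore] -/
theorem energyPerParticle_hcp_miePotential {q : ℕ} (hq : q ≠ 0) {a h : ℝ} (ha : a ≠ 0)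
    (hh : h ≠ 0) :
    (hcpPeriodicConfiguration ha hh).energyPerParticle (miePotential q) =
      -(∑' p : ↥(hcpStacking a h), (2 * (‖(p : EuclideanSpace ℝ (Fin 3))‖)⁻¹ ^ q -
        (‖(p : EuclideanSpace ℝ (Fin 3))‖)⁻¹ ^ (2 * q))) /
        (4 * (q : ℝ)) := by
  rw [energyPerParticle_hcp_eq_half_tsum ha hh (miePotential q) (miePotential_zero hq)]
  simp_rw [miePotential_eq_neg_mul_phi hq]
  rw [tsum_mul_left]
  have hq' : (q : ℝ) ≠ 0 := Nat.cast_ne_zero.2 hq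
  field_simp
  ring

end Summit.AtomisticToContinuum.Crystallization.Theorems.DominationEnergyLimit

end
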